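import Summits.Ventures.PercRepro.RankLevelSetUpFiveTargets

/-! # RankLevelSetUpFiveDegree — A HYPERPLANE MEETS A LINE IN AT MOST TWO POINTS, AND THE DEGREE OF A BAD MEMBER
(night-1 g41; dossier §53.5; on `RankLevelSetUpFiveTargets`)

The charging of §53 needs a lower bound on the number of type-B targets of a bad member `W`: with `R := W ∖ b`,
`H := cl R` and a valid coloop `c`, the admissible line points are `Λ(W, c) = {ℓ ∈ L' : {ℓ, c} ⊄ H} ⊇ L' ∖ H`, and
`#(L' ∖ H) ≥ #L' − 2` because a closure not containing the rank-`2` set `L'` meets its line in a flat of rank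
`≤ 1`, i.e. in at most two points (no parallel triple): **`ncard_inter_closure_le_two`** — and more precisely
**`ncard_closure_inter_closure_le_two`** for the whole line `cl L'`, which also absorbs the points of `W` on the
line. **`lambda_superset`** / **`lambda_eq_of_notMem`** describe `Λ(W, c)`, and **`ncard_lambda_ge`** is the bound
`#Λ(W, c) ≥ #L' − 2`. Every declaration has a docstring; imports: the cell's own modules and Mathlib only.
Axioms: standard. -/

namespace PercRepro

open Set Matroid

variable {α : Type}

/-- **A closure not containing a rank-`≤ 2` set `L'` (nonloops, no parallel triple) contains at most two points
of `cl L'`**: `cl L' ∩ cl R` is a flat of rank `≤ 1` (rank `2` would force `cl (cl L' ∩ cl R) = cl L' ∋ L'`). -/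
lemma ncard_closure_inter_closure_le_two {N : Matroid α} [N.Finite] {L' R : Set α} (hLE : L' ⊆ N.E)
    (hnl : ∀ e ∈ N.E, N.IsNonloop e)
    (hnt : ∀ p ∈ N.E, ∀ q ∈ N.E, ∀ r ∈ N.E, p ≠ q → p ≠ r → q ≠ r → q ∈ N.closure {p} → r ∉ N.closure {p})
    (hL2 : N.eRk L' ≤ 2) (hLH : ¬ L' ⊆ N.closure R) : (N.closure L' ∩ N.closure R).ncard ≤ 2 := by
  by_contra hcon
  set X := N.closure L' ∩ N.closure R with hX
  have hXE : X ⊆ N.E := Set.inter_subset_left.trans (N.closure_subset_ground L')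
  have h2 : 2 ≤ N.eRk X :=
    two_le_eRk_of_two_lt_ncard hXE (fun e he => hnl e (hXE he))
      (fun p hp q hq r hr => hnt p (hXE hp) q (hXE hq) r (hXE hr)) (not_le.mp hcon)
  have hXL : X ⊆ N.closure L' := Set.inter_subset_left
  have hrk : N.eRk (N.closure L') ≤ N.eRk X := by
    rw [N.eRk_closure_eq]; exact hL2.trans h2
  have hcl : N.closure X = N.closure (N.closure L') :=
    (N.isRkFinite_of_finite (N.ground_finite.subset hXE)).closure_eq_closure_of_subset_of_eRk_ge_eRk hXL hrk
  rw [N.closure_closure] at hcl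
  apply hLH
  intro x hx
  have hx' : x ∈ N.closure X := by rw [hcl]; exact N.subset_closure _ hLE hx
  have hXR : N.closure X ⊆ N.closure R := by
    have : X ⊆ N.closure R := Set.inter_subset_right
    exact N.closure_subset_closure_of_subset_closure this
  exact hXR hx'

/-- **A closure not containing a rank-`≤ 2` set meets it in at most two points.** -/
lemma ncard_inter_closure_le_two {N : Matroid α} [N.Finite] {L' R : Set α} (hLE : L' ⊆ N.E)
    (hnl : ∀ e ∈ N.E, N.IsNonloop e)
    (hnt : ∀ p ∈ N.E, ∀ q ∈ N.E, ∀ r ∈ N.E, p ≠ q → p ≠ r → q ≠ r → q ∈ N.closure {p} → r ∉ N.closure {p})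
    (hL2 : N.eRk L' ≤ 2) (hLH : ¬ L' ⊆ N.closure R) : (L' ∩ N.closure R).ncard ≤ 2 := by
  have h := ncard_closure_inter_closure_le_two hLE hnl hnt hL2 hLH
  refine le_trans (Set.ncard_le_ncard ?_ (N.ground_finite.subset
    (Set.inter_subset_left.trans (N.closure_subset_ground L')))) h
  exact Set.inter_subset_inter_left _ (N.subset_closure L' hLE)

/-- **The admissible line points of a valid coloop contain `L' ∖ H`.** -/
lemma lambda_superset {N : Matroid α} (L' R : Set α) (c : α) :
    L' \ N.closure R ⊆ {ℓ ∈ L' | ¬ ({ℓ, c} ⊆ N.closure R)} := by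
  intro ℓ hℓ
  refine ⟨hℓ.1, fun h => hℓ.2 (h (Set.mem_insert ℓ {c}))⟩

/-- **If the coloop is off `H`, every line point is admissible.** -/
lemma lambda_eq_of_notMem {N : Matroid α} (L' R : Set α) {c : α} (hc : c ∉ N.closure R) :
    {ℓ ∈ L' | ¬ ({ℓ, c} ⊆ N.closure R)} = L' := by
  ext ℓ
  constructor
  · exact fun h => h.1
  · intro h
    exact ⟨h, fun hsub => hc (hsub (Set.mem_insert_of_mem ℓ rfl))⟩

/-- **THE DEGREE BOUND** (night-1 g41, §53.5): for a rank-`≤ 2` set `L'` of nonloops without a parallel triple not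
inside `H = cl R`, every `c` has `#Λ(W, c) = #{ℓ ∈ L' : {ℓ, c} ⊄ H} ≥ #L' − 2`. -/
lemma ncard_lambda_ge {N : Matroid α} [N.Finite] {L' R : Set α} (hLE : L' ⊆ N.E)
    (hnl : ∀ e ∈ N.E, N.IsNonloop e)
    (hnt : ∀ p ∈ N.E, ∀ q ∈ N.E, ∀ r ∈ N.E, p ≠ q → p ≠ r → q ≠ r → q ∈ N.closure {p} → r ∉ N.closure {p})
    (hL2 : N.eRk L' ≤ 2) (hLH : ¬ L' ⊆ N.closure R) (c : α) :
    L'.ncard - 2 ≤ {ℓ ∈ L' | ¬ ({ℓ, c} ⊆ N.closure R)}.ncard := by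
  have hfin : L'.Finite := N.ground_finite.subset hLE
  have h1 : (L' \ N.closure R).ncard ≤ {ℓ ∈ L' | ¬ ({ℓ, c} ⊆ N.closure R)}.ncard :=
    Set.ncard_le_ncard (lambda_superset L' R c) (hfin.subset (fun x hx => hx.1))
  have h2 : (L' \ N.closure R).ncard = L'.ncard - (L' ∩ N.closure R).ncard := by
    have := Set.ncard_inter_add_ncard_sdiff_eq_ncard L' (N.closure R) hfin
    omega
  have h3 := ncard_inter_closure_le_two hLE hnl hnt hL2 hLH
  omega

/-- **The two points of the line inside `H` absorb the points of `W` on the line**: if `S ⊆ cl L' ∩ cl R` is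
disjoint from `L'`, then `#(L' ∩ cl R) + #S ≤ 2`. -/
lemma ncard_inter_closure_add_le_two {N : Matroid α} [N.Finite] {L' R S : Set α} (hLE : L' ⊆ N.E)
    (hnl : ∀ e ∈ N.E, N.IsNonloop e)
    (hnt : ∀ p ∈ N.E, ∀ q ∈ N.E, ∀ r ∈ N.E, p ≠ q → p ≠ r → q ≠ r → q ∈ N.closure {p} → r ∉ N.closure {p})
    (hL2 : N.eRk L' ≤ 2) (hLH : ¬ L' ⊆ N.closure R) (hS : S ⊆ N.closure L' ∩ N.closure R)
    (hSL : Disjoint S L') : (L' ∩ N.closure R).ncard + S.ncard ≤ 2 := by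
  have h := ncard_closure_inter_closure_le_two hLE hnl hnt hL2 hLH
  have hXfin : (N.closure L' ∩ N.closure R).Finite :=
    N.ground_finite.subset (Set.inter_subset_left.trans (N.closure_subset_ground L'))
  have hsub : (L' ∩ N.closure R) ∪ S ⊆ N.closure L' ∩ N.closure R := by
    intro x hx
    rcases hx with hx | hx
    · exact ⟨N.subset_closure L' hLE hx.1, hx.2⟩
    · exact hS hx
  have hdj : Disjoint (L' ∩ N.closure R) S := by
    rw [Set.disjoint_left]
    intro x hx hxS
    exact hSL.notMem_of_mem_left hxS hx.1
  have hle : ((L' ∩ N.closure R) ∪ S).ncard ≤ 2 := (Set.ncard_le_ncard hsub hXfin).trans h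
  rw [Set.ncard_union_eq hdj (hXfin.subset (hsub.trans' Set.subset_union_left))
    (hXfin.subset (hsub.trans' Set.subset_union_right))] at hle
  exact hle

end PercRepro
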